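import Mathlib
import HarnessLib
import Summits.ValiantsHypothesis.ValiantsHypothesis.Theses.PermanentalCones
import Literature.Computability.AlgebraicComplexity.DeterminantalComplexity
import Literature.Computability.AlgebraicComplexity.DeterminantalConormalBoundKernelAlgebra
import Literature.Computability.AlgebraicComplexity.DeterminantalConormalBoundProofs
import Literature.AlgebraicGeometry.HyperbolicPolynomials.HyperbolicityCone

/-!
# ValiantsHypothesis / PermanentalCones — `HyperbolicVPShadow`, stub A: the linear real-spectrum
# normal form of an affine determinantal representation of a hyperbolic form

Route `PermanentalCones`, item `stmt-ValiantsHypothesis-8655` (crux `HyperbolicVPShadow`), line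
`birth`, stub `stub_linearRealSpectrumNormalForm`.

Let `M = M₀ + Σⱼ Xⱼ Mⱼ` be an `N × N` matrix of real affine-linear forms with `det M = g`
(`IsAffineDetRepr g M`), `g` homogeneous of degree `d`, `g(e) ≠ 0`, and suppose every complex zero
`z` of `z ↦ g(x + z e)` (`x` real) is real. Write `M(x) = M₀ + L(x)` with `L(x) = Σⱼ xⱼ Mⱼ` the
linear part, and put `P x := M(e)⁻¹ · L(x)` (a linear pencil of the same size `N`). For a field
`K ⊇ ℝ` (`K = ℝ` or `ℂ`) and `t ∈ K`, `t ≠ 0`,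

  `M(e) · (P x + t·1) = L(x) + t M(e) = t M₀ + L(x + t e) = t · M(t⁻¹ (x + t e))`,

so `g(e) · det (P x + t·1) = t ^ N · g(t⁻¹ (x + t e)) = t ^ N · t ^ (-d) · g(x + t e)`
(`hyperbolicVPShadow_det_pencil`). With `K = ℂ`, `t = -z`: an eigenvalue `z ≠ 0` of `P x` is
minus a zero of `z ↦ g(x + z e)`, hence real; with `K = ℝ`, `t = τ > 0`:
`det (P x + τ·1) ≠ 0 ↔ g(x + τ e) ≠ 0`, so the closed "no negative eigenvalue" cone of `P` is the
closed hyperbolicity cone of `g`.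
-/

-- `<Problem> = <Summit>` for this single-conjunct summit (lakefile sets the same option tree-wide).
set_option linter.dupNamespace false

namespace Summit.ValiantsHypothesis.ValiantsHypothesis.Theorems

open MvPolynomial Literature.Computability.AlgebraicComplexity

/-- Affine expansion after a change of scalars: for `p` of total degree `≤ 1` and a ring map
`ι : ℝ → K`, `(ι p)(w) = ι p₀ + Σⱼ ι pⱼ · wⱼ` with `p₀ = coeff 0 p`, `pⱼ = coeff eⱼ p`. [folklore] -/
theorem hyperbolicVPShadow_eval_map_affine {K : Type*} [CommSemiring K] {n : ℕ} (ι : ℝ →+* K)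
    {p : MvPolynomial (Fin n) ℝ} (hp : p.totalDegree ≤ 1) (w : Fin n → K) :
    eval w (map ι p) = ι (coeff 0 p) + ∑ j, ι (coeff (Finsupp.single j 1) p) * w j := by
  conv_lhs => rw [DeterminantalConormal.eq_C_add_sum_of_totalDegree_le_one hp]
  simp only [map_add, map_sum, map_mul, map_C, map_X, eval_C, eval_X]

/-- `det` commutes with "change scalars along `ι`, then evaluate at `w`":
`det (M.map (p ↦ (ι p)(w))) = (ι (det M))(w)`. [folklore] -/
theorem hyperbolicVPShadow_det_map_eval_map {K : Type*} [CommRing K] {n N : ℕ} (ι : ℝ →+* K)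
    (M : Matrix (Fin N) (Fin N) (MvPolynomial (Fin n) ℝ)) (w : Fin n → K) :
    (M.map fun p => eval w (map ι p)).det = eval w (map ι M.det) := by
  have h : (M.map fun p => eval w (map ι p)) = (M.map (map ι)).map (eval w) := by
    rw [Matrix.map_map]
    rfl
  rw [h, DeterminantalConormal.det_map_eval, ← RingHom.mapMatrix_apply, ← RingHom.map_det]

/-- The key matrix identity behind the normal form: for an affine pencil `M = M₀ + Σⱼ Xⱼ Mⱼ` with
linear part `L(x) = Σⱼ xⱼ Mⱼ` (given entrywise by `hLx`) and `t ≠ 0` in a field `K ⊇ ℝ`,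
`L(x) + t · M(e) = t · M(t⁻¹ (x + t e))` over `K`. [folklore] -/
theorem hyperbolicVPShadow_linPart_add_smul_eval {K : Type*} [Field K] {n N : ℕ} (ι : ℝ →+* K)
    {M : Matrix (Fin N) (Fin N) (MvPolynomial (Fin n) ℝ)} (hdeg : ∀ r c, (M r c).totalDegree ≤ 1)
    (e : Fin n → ℝ) {x : Fin n → ℝ} {Lx : Matrix (Fin N) (Fin N) ℝ}
    (hLx : ∀ r c, Lx r c = ∑ j, x j * coeff (Finsupp.single j 1) (M r c)) {t : K} (ht : t ≠ 0) :
    Lx.map ι + t • (M.map (eval e)).map ι =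
      t • M.map (fun p => eval (t⁻¹ • fun j => ι (x j) + t * ι (e j)) (map ι p)) := by
  ext r c
  simp only [Matrix.add_apply, Matrix.smul_apply, Matrix.map_apply, smul_eq_mul]
  rw [hLx, DeterminantalConormal.eval_eq_coeff_zero_add_sum (hdeg r c) e,
    hyperbolicVPShadow_eval_map_affine ι (hdeg r c)]
  simp only [Pi.smul_apply, smul_eq_mul, map_add, map_sum, map_mul, mul_add, Finset.mul_sum,
    Finset.sum_add_distrib, inv_mul_cancel_left₀ ht]
  have hx : ∀ j : Fin n, t * (ι (coeff (Finsupp.single j 1) (M r c)) * (t⁻¹ * ι (x j))) =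
      ι (x j) * ι (coeff (Finsupp.single j 1) (M r c)) := fun j => by
    rw [mul_left_comm (ι _) t⁻¹, mul_inv_cancel_left₀ ht, mul_comm]
  simp only [hx]
  ring

/-- **Determinant of the normalised pencil.** For an affine determinantal representation `M` of
a form `g` of degree `d` with `g(e) ≠ 0`, the linear pencil `P x = M(e)⁻¹ · L(x)` satisfies, for
every `t ≠ 0` in a field `K ⊇ ℝ`,
`ι (g e) · det (P x + t·1) = t ^ N · (t⁻¹) ^ d · (ι g)(x + t e)`. [folklore] -/
theorem hyperbolicVPShadow_det_pencil {K : Type*} [Field K] {n N : ℕ} (ι : ℝ →+* K)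
    {g : MvPolynomial (Fin n) ℝ} {M : Matrix (Fin N) (Fin N) (MvPolynomial (Fin n) ℝ)}
    (hM : IsAffineDetRepr g M) {d : ℕ} (hd : g.IsHomogeneous d) {e : Fin n → ℝ}
    (he : eval e g ≠ 0) {x : Fin n → ℝ} {Lx : Matrix (Fin N) (Fin N) ℝ}
    (hLx : ∀ r c, Lx r c = ∑ j, x j * coeff (Finsupp.single j 1) (M r c)) {t : K} (ht : t ≠ 0) :
    ι (eval e g) * (((M.map (eval e))⁻¹ * Lx).map ι + t • (1 : Matrix (Fin N) (Fin N) K)).det =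
      t ^ N * (t⁻¹ ^ d * eval (fun j => ι (x j) + t * ι (e j)) (map ι g)) := by
  obtain ⟨hdeg, hdet⟩ := hM
  have hB : (M.map (eval e)).det = eval e g := by
    rw [DeterminantalConormal.det_map_eval, hdet]
  have hBu : IsUnit (M.map (eval e)).det := by
    rw [hB]
    exact isUnit_iff_ne_zero.mpr he
  have h1 : (M.map (eval e)).map ι * (((M.map (eval e))⁻¹ * Lx).map ι + t • 1) =
      Lx.map ι + t • (M.map (eval e)).map ι := by
    rw [Matrix.mul_add, ← Matrix.map_mul, Matrix.mul_nonsing_inv_cancel_left _ _ hBu,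
      Matrix.mul_smul, Matrix.mul_one]
  rw [← hB, RingHom.map_det, RingHom.mapMatrix_apply, ← Matrix.det_mul, h1,
    hyperbolicVPShadow_linPart_add_smul_eval ι hdeg e hLx ht, Matrix.det_smul, Fintype.card_fin,
    hyperbolicVPShadow_det_map_eval_map, hdet, (hd.map ι).eval_smul_eq]

/-- **Stub A of the line `birth` of `HyperbolicVPShadow` (linear real-spectrum normal form).**
An affine real determinantal representation `M` (size `N`) of a homogeneous `g` hyperbolic with
respect to `e` yields a LINEAR pencil `P` of the same size all of whose values have only real
eigenvalues and whose closed "no negative eigenvalue" cone `{x : ∀ τ > 0, det (P x + τ·1) ≠ 0}`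
is the closed hyperbolicity cone `{x : ∀ τ > 0, g(x + τ e) ≠ 0}`; explicitly
`P x = M(e)⁻¹ · L(x)` with `L` the linear part of `M`. [folklore] -/
theorem stub_linearRealSpectrumNormalForm :
    ∀ (n N : ℕ) (g : MvPolynomial (Fin n) ℝ) (M : Matrix (Fin N) (Fin N) (MvPolynomial (Fin n) ℝ))
      (e : Fin n → ℝ), IsAffineDetRepr g M → (∃ d : ℕ, g.IsHomogeneous d) →
      (MvPolynomial.eval e g ≠ 0 ∧ ∀ (x : Fin n → ℝ) (z : ℂ),
        MvPolynomial.eval (fun j => (x j : ℂ) + z * (e j : ℂ))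
          (MvPolynomial.map (algebraMap ℝ ℂ) g) = 0 → z.im = 0) →
      ∃ P : (Fin n → ℝ) →ₗ[ℝ] Matrix (Fin N) (Fin N) ℝ,
        (∀ (x : Fin n → ℝ) (z : ℂ),
          ((P x).map (algebraMap ℝ ℂ) - z • (1 : Matrix (Fin N) (Fin N) ℂ)).det = 0 → z.im = 0) ∧
        ∀ x : Fin n → ℝ, (∀ τ : ℝ, 0 < τ → MvPolynomial.eval (x + τ • e) g ≠ 0) ↔
          ∀ τ : ℝ, 0 < τ → (P x + τ • (1 : Matrix (Fin N) (Fin N) ℝ)).det ≠ 0 := by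
  intro n N g M e hM hhom hhyp
  obtain ⟨d, hd⟩ := hhom
  obtain ⟨he, hreal⟩ := hhyp
  -- the linear part `L x = Σⱼ xⱼ • Mⱼ` of the affine pencil `M = M₀ + Σⱼ Xⱼ • Mⱼ`
  let L : (Fin n → ℝ) →ₗ[ℝ] Matrix (Fin N) (Fin N) ℝ :=
    ∑ j : Fin n, (LinearMap.proj j : (Fin n → ℝ) →ₗ[ℝ] ℝ).smulRight
      (M.map fun p => coeff (Finsupp.single j 1) p)
  have hL : ∀ (x : Fin n → ℝ) (r c : Fin N),
      L x r c = ∑ j, x j * coeff (Finsupp.single j 1) (M r c) := by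
    intro x r c
    simp only [L, LinearMap.sum_apply, LinearMap.smulRight_apply, LinearMap.proj_apply,
      Matrix.sum_apply, Matrix.smul_apply, Matrix.map_apply, smul_eq_mul]
  -- the normalised linear pencil `P x = M(e)⁻¹ · L x`
  refine ⟨(LinearMap.mulLeft ℝ (M.map (eval e))⁻¹).comp L, fun x z hz => ?_, fun x => ?_⟩
  · -- every eigenvalue `z` of `P x` is real: `-z` is a zero of `z ↦ g(x + z e)` (or `z = 0`)
    by_cases hz0 : z = 0
    · rw [hz0, Complex.zero_im]
    have hz' : -z ≠ 0 := neg_ne_zero.mpr hz0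
    have key := hyperbolicVPShadow_det_pencil (algebraMap ℝ ℂ) hM hd he (hL x) hz'
    rw [LinearMap.comp_apply, LinearMap.mulLeft_apply, sub_eq_add_neg, ← neg_smul] at hz
    rw [hz, mul_zero] at key
    have h0 : eval (fun j => algebraMap ℝ ℂ (x j) + -z * algebraMap ℝ ℂ (e j))
        (map (algebraMap ℝ ℂ) g) = 0 := by
      rcases mul_eq_zero.mp key.symm with h | h
      · exact absurd h (pow_ne_zero _ hz')
      · exact (mul_eq_zero.mp h).resolve_left (pow_ne_zero _ (inv_ne_zero hz'))
    have him := hreal x (-z) h0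
    rwa [Complex.neg_im, neg_eq_zero] at him
  · -- the closed cones agree: `g(e) · det (P x + τ·1) = τ ^ N · τ⁻¹ ^ d · g(x + τ e)` for `τ > 0`
    refine forall_congr' fun τ => imp_congr_right fun hτ => Iff.not ?_
    have key := hyperbolicVPShadow_det_pencil (RingHom.id ℝ) hM hd he (hL x) hτ.ne'
    have hxe : (fun j => (RingHom.id ℝ) (x j) + τ * (RingHom.id ℝ) (e j)) = x + τ • e := by
      funext j
      simp only [RingHom.id_apply, Pi.add_apply, Pi.smul_apply, smul_eq_mul]
    rw [hxe, MvPolynomial.map_id, RingHom.id_apply, RingHom.coe_id, Matrix.map_id] at key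
    rw [LinearMap.comp_apply, LinearMap.mulLeft_apply]
    constructor
    · intro h
      rw [h, mul_zero, mul_zero] at key
      exact (mul_eq_zero.mp key).resolve_left he
    · intro h
      rw [h, mul_zero] at key
      rcases mul_eq_zero.mp key.symm with h' | h'
      · exact absurd h' (pow_ne_zero _ hτ.ne')
      · exact (mul_eq_zero.mp h').resolve_left (pow_ne_zero _ (inv_ne_zero hτ.ne'))

end Summit.ValiantsHypothesis.ValiantsHypothesis.Theorems
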